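import Mathlib
import HarnessLib
import HarnessLib.Audit
import Summits.AnomalousDissipation.AnomalousDissipation.Theses.DebrisQuanta
import Literature.Analysis.FluidPDE.CollapseDebris
import Literature.Analysis.FluidPDE.LerayHopfRestartTorus

/-!
# Line `birth` — BC3 skeleton for the crux `RobustDecayQuantumR` (stmt-AnomalousDissipation-10549)

Route `DebrisQuanta` (route-AnomalousDissipation-DebrisQuanta), crux (rank 3)
`Summit.AnomalousDissipation.AnomalousDissipation.Theses.DebrisQuanta.RobustDecayQuantumR`:
for all `2/3 < α < 1`, admissible profiles `W`, smooth divergence-free mean-zero steady forces `f`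
and constants `M c` there is `q > 0` such that along EVERY vanishing-viscosity sequence of global
Leray–Hopf solutions `u_j` forced by `f`, every debris state
`u_j(t_j) = b_j + D_{α,W}(· - a_j) + w_j` (`b_j` an `M`-calm background,
`‖w_j‖₂ ≤ c·ν_j^{(3-2α)/(2(1-α))}`) met at a POSITIVE time `t_j` from which the energy inequality
holds is followed by the burn `ν_j ∫_{t_j}^{t_j+1} ‖∇u_j‖₂² ≥ q`, eventually in `j`.

THE LINE (the route's own "first planned split" — inner reduction + puff law — typed on the torus,
no limit objects): the quantum is a property of the CAUCHY PROBLEM from near-debris data, and it is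
produced LOCALLY by the canonical datum. Three registered stubs, each a genuine lemma of the line:

* `stub_bareQuantum` (TURBULENT PUFF — the load-bearing, hardest stub; the ∀-twin of the route's
  milestone `DecayQuantumWeak` for every admissible profile): for the EXACT debris datum
  `x ↦ collapseDebris α W (x - a_j)` and ZERO force, every vanishing-viscosity family of global
  Leray–Hopf solutions burns `≥ q(α,W,σ) > 0` on every window `[0, σ]`, `0 < σ ≤ 1`, eventually.
  Why plausibly true: the inner rescaling `x - a = λy`, `t = λ^{1+α}s`, `u = λ^{-α}w`
  (`λ = ν^{1/(1-α)}`) sends `NS_ν` to unit-viscosity NS from the homogeneous cusp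
  `U_{α,W} = curl(|y|^{1-α}W(ŷ))`, whose local Reynolds number at radius `r` grows like `r^{1-α}`;
  the burn on `[0,σ]` is `λ^{3-2α}∫_0^{σλ^{-(1+α)}}‖∇w‖²`, positive in the limit iff the expanding
  flow obeys the `U³/L` law `∫_0^S‖∇w‖² ≳ S^{(3-2α)/(1+α)}` ("turbulent puff"); the laminar
  quasi-self-similar branch gives burn `~ ν` (the route's CHEAPEST FALSIFIER, axisymmetric no-swirl
  `W = e₂ × y`, refutes this stub first — exactly the crux's recorded risk). Size: XL / open
  (first fixed-datum anomalous dissipation for unforced 3-D NS; Jeong–Yoneda arXiv:1902.02032 Thm 3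
  reach only `ν^{a₀}`-floors, `a₀ < 1`, with `ν`-dependent data).
* `stub_tipUniversality` (UNIVERSALITY BELOW THE ARREST SCALE): the bare floors survive every
  modification of the datum of `L²`-size `≤ c·λ_j^{(3-2α)/2}` — the energy the cusp carries below
  the arrest scale `λ_j`. Why plausibly true: zooming out by `μ ≥ 1` in inner variables contracts
  the perturbation class (`‖w_μ‖₂ = μ^{-(3-2α)/2}‖w‖₂ → 0`) while `U_{α,W}` is invariant, so at the
  outer scales `r ≫ λ` that produce the quantum the datum's energy `~ r^{3-2α}` dominates
  `c²λ^{3-2α}`; an adversarial tip perturbation can at most fast-forward the flow by inner time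
  `O(c)`. Size: L (a compactness/asymptotic-self-similarity statement for the inner problem on
  `ℝ³`, local-energy solutions of Lemarié-Rieusset/Kikuchi–Seregin/Bradshaw–Tsai class in tree).
* `stub_calmDecoupling` (LOCALITY: CALM BACKGROUND AND STEADY FORCE DECOUPLE): the unforced floors
  (all windows `σ ≤ 1`, all tolerances `c'`) imply the floor on `[0,1]` for global Leray–Hopf
  solutions FORCED by `f` from data within tolerance of `b + D_{α,W}(· - a)`, `b` smooth
  divergence-free with `|b|, |∇b| ≤ M`. Why plausibly true: the quantum `q(σ₀)` is already
  produced on a short window `[0, σ₀(M, f, α, W)]` inside a ball of radius `σ₀^{1/(1+α)}` about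
  `a`, where the background is the constant drift `b(a)` (removed by the Galilean covariance of NS
  on `T³`, `LerayHopfGalileanTorus*` in tree) plus an `M`-Lipschitz shear distorting the puff by
  `e^{Mσ₀} ≈ 1`, and the force changes inner velocities by `λ^{1+2α}σ → 0`. Size: L
  (localised energy/enstrophy bookkeeping for Leray–Hopf solutions + Galilean boost; no blow-up
  theory).

COMPOSITION (sorry-free, standard axioms): `datumQuantum_of_stubSigs : stub₁-sig → stub₂-sig →
stub₃-sig → DatumForm` chains the three (bare floors ⟹ tip floors for every tolerance ⟹ the
forced/background floor on `[0,1]` = the DATUM FORM of the crux, written out as the theorem's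
conclusion: near-debris data at `t = 0`, the datum pinned by `strong_initial`), and
`RobustDecayQuantumR_of : RobustDecayQuantumR` — THE skeleton theorem, the only declaration of this
file whose head is the crux — derives the crux BY NAME from the datum form (instantiated with the
three `stub_*`) by RESTARTING at the good positive times: for `t_j > 0` with the energy inequality
from `t_j`, the translate `s ↦ u_j(s + t_j)` is a global Leray–Hopf solution forced by `f` from the
datum `u_j(t_j)` (`Torus.IsGlobalLerayHopf.isGlobalLerayHopf_translate`, tree, Robinson–Rodrigo–
Sadowski 2016 Def. 4.9 / p. 131), and `∫⁻_{(0,1)}‖∇u_j(· + t_j)‖² = ∫⁻_{(t_j,t_j+1)}‖∇u_j‖²`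
(`setLIntegral_Ioo_comp_add_right`). This is exactly where the line USES the repaired hypothesis
`0 < t_j` (the junk `t = 0` slice that refuted `RobustDecayQuantum`, stmt-2859, is never met: the
datum of the restarted problem is attained strongly). `sorry` occurs ONLY in the three `stub_*`.

Disproof used: no `Cruxes/RobustDecayQuantumR/Disproof.lean` exists yet (crux ls, 2026-08-17);
the negatives-index entry `Theorems.DebrisQuantaRobustDecayQuantum_refuted` (t = 0 junk slice) is
honoured as said above. BC3 probes (`stub → RobustDecayQuantumR`, `stub → AnomalousDissipation` by
`first | exact? | simpa | aesop`) are run in the sibling files `bc/probe_*.lean` of the registering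
seat and must fail (no stub is cheaply the crux or the summit).
-/

-- `Summit.<Summit>.<Problem>`: for the single-conjunct summit the duplicate `AnomalousDissipation.AnomalousDissipation` is mandated.
set_option linter.dupNamespace false
set_option linter.unusedVariables false

namespace Summit.AnomalousDissipation.AnomalousDissipation.Cruxes.RobustDecayQuantumR.Birth

open MeasureTheory Filter Set
open scoped RealInnerProductSpace ENNReal Topology
open Summit.AnomalousDissipation.AnomalousDissipation.Theses.DebrisQuanta

/-! ## The three registered stubs -/

/-- **Stub 1 — turbulent puff (bare decay quantum on every window).** For `2/3 < α < 1` and an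
admissible profile `W`, and every window length `0 < σ ≤ 1`, there is `q > 0` such that for all
viscosities `ν_j → 0`, centres `a_j ∈ T³` and global Leray–Hopf solutions `u_j` of the UNFORCED
Navier–Stokes equations from the exact debris datum `x ↦ D_{α,W}(x - a_j)`
(`Literature.Analysis.FluidPDE.collapseDebris`, by `rfl` the route's `let D`), eventually
`ν_j ∫_0^σ ‖∇u_j‖₂² ≥ q`. The hardest stub (fixed-datum anomalous dissipation for unforced 3-D NS,
∀ Leray–Hopf families); refuted first by the laminar-puff scenario for axisymmetric no-swirl `W`.
Sources: BronziShvydkoy2015 (Thm 1.1, Rem 1.2), Shvydkoy2017, JiaSverak2014, arXiv:1902.02032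
(Thm 3), Hopf1951. -/
theorem stub_bareQuantum :
    ∀ (α : ℝ) (W : EuclideanSpace ℝ (Fin 3) → EuclideanSpace ℝ (Fin 3)), 2/3 < α → α < 1 →
      Literature.Analysis.FluidPDE.CollapseDebris.IsAdmissibleProfile α W →
      ∀ σ : ℝ, 0 < σ → σ ≤ 1 → ∃ q : ℝ, 0 < q ∧
        ∀ (ν : ℕ → ℝ) (a : ℕ → UnitAddTorus (Fin 3))
          (u : ℕ → ℝ → UnitAddTorus (Fin 3) → EuclideanSpace ℝ (Fin 3)),
          (∀ j, 0 < ν j) → Filter.Tendsto ν Filter.atTop (nhds 0) →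
          (∀ j, Literature.Analysis.FluidPDE.Torus.IsGlobalLerayHopf (ν j) 0
            (fun x => Literature.Analysis.FluidPDE.collapseDebris α W (x - a j)) (u j)) →
          ∀ᶠ j in Filter.atTop, q ≤ ν j * (∫⁻ s in Set.Ioo 0 σ,
            Literature.Analysis.FunctionSpaces.Torus.eGradNormSq (u j s)).toReal := by
  sorry

/-- **Stub 2 — universality below the arrest scale.** For `2/3 < α < 1` and admissible `W`: IF the
bare floors of Stub 1 hold for `(α, W)`, THEN for every tolerance constant `c` and every window
`0 < σ ≤ 1` there is `q > 0` such that for all `ν_j → 0`, centres `a_j`, data `u₀_j` with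
`‖u₀_j - D_{α,W}(· - a_j)‖_{L²} ≤ c·ν_j^{(3-2α)/(2(1-α))}` (`= c·λ_j^{(3-2α)/2}`, the energy the
cusp carries below the arrest scale `λ_j = ν_j^{1/(1-α)}`) and unforced global Leray–Hopf
solutions `u_j` from `u₀_j`, eventually `ν_j ∫_0^σ ‖∇u_j‖₂² ≥ q`. Mechanism: the inner
perturbation class contracts under zooming out while the cusp is scale-invariant (asymptotic
self-similarity of the expanding puff). Sources: doi:10.1007/s00205-020-01510-w,
doi:10.1512/iumj.2022.71.8789, arXiv:1906.11038 (local-energy solutions from rough homogeneous-type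
data), BronziShvydkoy2015. -/
theorem stub_tipUniversality :
    ∀ (α : ℝ) (W : EuclideanSpace ℝ (Fin 3) → EuclideanSpace ℝ (Fin 3)), 2/3 < α → α < 1 →
      Literature.Analysis.FluidPDE.CollapseDebris.IsAdmissibleProfile α W →
      (∀ σ : ℝ, 0 < σ → σ ≤ 1 → ∃ q : ℝ, 0 < q ∧
        ∀ (ν : ℕ → ℝ) (a : ℕ → UnitAddTorus (Fin 3))
          (u : ℕ → ℝ → UnitAddTorus (Fin 3) → EuclideanSpace ℝ (Fin 3)),
          (∀ j, 0 < ν j) → Filter.Tendsto ν Filter.atTop (nhds 0) →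
          (∀ j, Literature.Analysis.FluidPDE.Torus.IsGlobalLerayHopf (ν j) 0
            (fun x => Literature.Analysis.FluidPDE.collapseDebris α W (x - a j)) (u j)) →
          ∀ᶠ j in Filter.atTop, q ≤ ν j * (∫⁻ s in Set.Ioo 0 σ,
            Literature.Analysis.FunctionSpaces.Torus.eGradNormSq (u j s)).toReal) →
      ∀ (c σ : ℝ), 0 < σ → σ ≤ 1 → ∃ q : ℝ, 0 < q ∧
        ∀ (ν : ℕ → ℝ) (a : ℕ → UnitAddTorus (Fin 3))
          (u₀ : ℕ → UnitAddTorus (Fin 3) → EuclideanSpace ℝ (Fin 3))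
          (u : ℕ → ℝ → UnitAddTorus (Fin 3) → EuclideanSpace ℝ (Fin 3)),
          (∀ j, 0 < ν j) → Filter.Tendsto ν Filter.atTop (nhds 0) →
          (∀ j, Literature.Analysis.FluidPDE.Torus.IsGlobalLerayHopf (ν j) 0 (u₀ j) (u j)) →
          (∀ j, MeasureTheory.eLpNorm
              (fun x => u₀ j x - Literature.Analysis.FluidPDE.collapseDebris α W (x - a j))
              2 MeasureTheory.volume ≤ ENNReal.ofReal (c * (ν j) ^ ((3 - 2 * α) / (2 * (1 - α))))) →
          ∀ᶠ j in Filter.atTop, q ≤ ν j * (∫⁻ s in Set.Ioo 0 σ,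
            Literature.Analysis.FunctionSpaces.Torus.eGradNormSq (u j s)).toReal := by
  sorry

/-- **Stub 3 — locality: calm backgrounds and steady forces decouple.** For `2/3 < α < 1`,
admissible `W`, a smooth divergence-free mean-zero steady force `f` and constants `M c`: IF the
unforced floors of Stub 2 hold for `(α, W)` at every tolerance `c'` and every window `σ ≤ 1`, THEN
there is `q > 0` such that for all `ν_j → 0`, centres `a_j`, backgrounds `b_j` (smooth,
divergence-free, `|b_j|, |∇b_j| ≤ M`), data `u₀_j` with
`‖u₀_j - b_j - D_{α,W}(· - a_j)‖_{L²} ≤ c·ν_j^{(3-2α)/(2(1-α))}` and global Leray–Hopf solutions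
`u_j` FORCED BY `f` from `u₀_j`, eventually `ν_j ∫_0^1 ‖∇u_j‖₂² ≥ q` (the DATUM FORM of the crux).
Mechanism: the quantum is produced on a short window in a small ball about `a_j`, where the
background is a constant drift (Galilean covariance on `T³`) plus an `M`-Lipschitz shear and the
force is perturbative. Sources: Hopf1951, Galdi2000, RobinsonRodrigoSadowski2016 (Def. 4.9),
BrueDeLellis2023 (§1), arXiv:2207.06301. -/
theorem stub_calmDecoupling :
    ∀ (α : ℝ) (W : EuclideanSpace ℝ (Fin 3) → EuclideanSpace ℝ (Fin 3))
      (f : UnitAddTorus (Fin 3) → EuclideanSpace ℝ (Fin 3)) (M c : ℝ), 2/3 < α → α < 1 →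
      Literature.Analysis.FluidPDE.CollapseDebris.IsAdmissibleProfile α W →
      Literature.Analysis.FunctionSpaces.Torus.IsSmooth f →
      Literature.Analysis.FunctionSpaces.Torus.IsDivFree f →
      Literature.Analysis.FunctionSpaces.Torus.HasZeroMean f →
      (∀ (c' σ : ℝ), 0 < σ → σ ≤ 1 → ∃ q : ℝ, 0 < q ∧
        ∀ (ν : ℕ → ℝ) (a : ℕ → UnitAddTorus (Fin 3))
          (u₀ : ℕ → UnitAddTorus (Fin 3) → EuclideanSpace ℝ (Fin 3))
          (u : ℕ → ℝ → UnitAddTorus (Fin 3) → EuclideanSpace ℝ (Fin 3)),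
          (∀ j, 0 < ν j) → Filter.Tendsto ν Filter.atTop (nhds 0) →
          (∀ j, Literature.Analysis.FluidPDE.Torus.IsGlobalLerayHopf (ν j) 0 (u₀ j) (u j)) →
          (∀ j, MeasureTheory.eLpNorm
              (fun x => u₀ j x - Literature.Analysis.FluidPDE.collapseDebris α W (x - a j))
              2 MeasureTheory.volume ≤ ENNReal.ofReal (c' * (ν j) ^ ((3 - 2 * α) / (2 * (1 - α))))) →
          ∀ᶠ j in Filter.atTop, q ≤ ν j * (∫⁻ s in Set.Ioo 0 σ,
            Literature.Analysis.FunctionSpaces.Torus.eGradNormSq (u j s)).toReal) →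
      ∃ q : ℝ, 0 < q ∧
        ∀ (ν : ℕ → ℝ) (a : ℕ → UnitAddTorus (Fin 3))
          (b : ℕ → UnitAddTorus (Fin 3) → EuclideanSpace ℝ (Fin 3))
          (u₀ : ℕ → UnitAddTorus (Fin 3) → EuclideanSpace ℝ (Fin 3))
          (u : ℕ → ℝ → UnitAddTorus (Fin 3) → EuclideanSpace ℝ (Fin 3)),
          (∀ j, 0 < ν j) → Filter.Tendsto ν Filter.atTop (nhds 0) →
          (∀ j, Literature.Analysis.FluidPDE.Torus.IsGlobalLerayHopf (ν j) (fun _ => f) (u₀ j) (u j)) →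
          (∀ j, Literature.Analysis.FunctionSpaces.Torus.IsSmooth (b j) ∧
            Literature.Analysis.FunctionSpaces.Torus.IsDivFree (b j) ∧
            ∀ y : EuclideanSpace ℝ (Fin 3),
              ‖Literature.Analysis.FunctionSpaces.Torus.lift (b j) y‖ ≤ M ∧
              ‖fderiv ℝ (Literature.Analysis.FunctionSpaces.Torus.lift (b j)) y‖ ≤ M) →
          (∀ j, MeasureTheory.eLpNorm
              (fun x => u₀ j x - b j x - Literature.Analysis.FluidPDE.collapseDebris α W (x - a j))
              2 MeasureTheory.volume ≤ ENNReal.ofReal (c * (ν j) ^ ((3 - 2 * α) / (2 * (1 - α))))) →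
          ∀ᶠ j in Filter.atTop, q ≤ ν j * (∫⁻ s in Set.Ioo 0 1,
            Literature.Analysis.FunctionSpaces.Torus.eGradNormSq (u j s)).toReal := by
  sorry

/-! ## Sorry-free composition -/

/-- **Chaining the three stub signatures gives the datum form of the crux** (near-debris DATA at
`t = 0`, pinned by `strong_initial`; calm background; steady force; floor on `[0, 1]`): bare floors
⟹ tip floors for every tolerance ⟹ the forced/background floor — each stub is load-bearing.
[folklore] -/
theorem datumQuantum_of_stubSigs
    (h₁ : ∀ (α : ℝ) (W : EuclideanSpace ℝ (Fin 3) → EuclideanSpace ℝ (Fin 3)), 2/3 < α → α < 1 →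
      Literature.Analysis.FluidPDE.CollapseDebris.IsAdmissibleProfile α W →
      ∀ σ : ℝ, 0 < σ → σ ≤ 1 → ∃ q : ℝ, 0 < q ∧
        ∀ (ν : ℕ → ℝ) (a : ℕ → UnitAddTorus (Fin 3))
          (u : ℕ → ℝ → UnitAddTorus (Fin 3) → EuclideanSpace ℝ (Fin 3)),
          (∀ j, 0 < ν j) → Filter.Tendsto ν Filter.atTop (nhds 0) →
          (∀ j, Literature.Analysis.FluidPDE.Torus.IsGlobalLerayHopf (ν j) 0
            (fun x => Literature.Analysis.FluidPDE.collapseDebris α W (x - a j)) (u j)) →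
          ∀ᶠ j in Filter.atTop, q ≤ ν j * (∫⁻ s in Set.Ioo 0 σ,
            Literature.Analysis.FunctionSpaces.Torus.eGradNormSq (u j s)).toReal)
    (h₂ : ∀ (α : ℝ) (W : EuclideanSpace ℝ (Fin 3) → EuclideanSpace ℝ (Fin 3)), 2/3 < α → α < 1 →
      Literature.Analysis.FluidPDE.CollapseDebris.IsAdmissibleProfile α W →
      (∀ σ : ℝ, 0 < σ → σ ≤ 1 → ∃ q : ℝ, 0 < q ∧
        ∀ (ν : ℕ → ℝ) (a : ℕ → UnitAddTorus (Fin 3))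
          (u : ℕ → ℝ → UnitAddTorus (Fin 3) → EuclideanSpace ℝ (Fin 3)),
          (∀ j, 0 < ν j) → Filter.Tendsto ν Filter.atTop (nhds 0) →
          (∀ j, Literature.Analysis.FluidPDE.Torus.IsGlobalLerayHopf (ν j) 0
            (fun x => Literature.Analysis.FluidPDE.collapseDebris α W (x - a j)) (u j)) →
          ∀ᶠ j in Filter.atTop, q ≤ ν j * (∫⁻ s in Set.Ioo 0 σ,
            Literature.Analysis.FunctionSpaces.Torus.eGradNormSq (u j s)).toReal) →
      ∀ (c σ : ℝ), 0 < σ → σ ≤ 1 → ∃ q : ℝ, 0 < q ∧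
        ∀ (ν : ℕ → ℝ) (a : ℕ → UnitAddTorus (Fin 3))
          (u₀ : ℕ → UnitAddTorus (Fin 3) → EuclideanSpace ℝ (Fin 3))
          (u : ℕ → ℝ → UnitAddTorus (Fin 3) → EuclideanSpace ℝ (Fin 3)),
          (∀ j, 0 < ν j) → Filter.Tendsto ν Filter.atTop (nhds 0) →
          (∀ j, Literature.Analysis.FluidPDE.Torus.IsGlobalLerayHopf (ν j) 0 (u₀ j) (u j)) →
          (∀ j, MeasureTheory.eLpNorm
              (fun x => u₀ j x - Literature.Analysis.FluidPDE.collapseDebris α W (x - a j))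
              2 MeasureTheory.volume ≤ ENNReal.ofReal (c * (ν j) ^ ((3 - 2 * α) / (2 * (1 - α))))) →
          ∀ᶠ j in Filter.atTop, q ≤ ν j * (∫⁻ s in Set.Ioo 0 σ,
            Literature.Analysis.FunctionSpaces.Torus.eGradNormSq (u j s)).toReal)
    (h₃ : ∀ (α : ℝ) (W : EuclideanSpace ℝ (Fin 3) → EuclideanSpace ℝ (Fin 3))
      (f : UnitAddTorus (Fin 3) → EuclideanSpace ℝ (Fin 3)) (M c : ℝ), 2/3 < α → α < 1 →
      Literature.Analysis.FluidPDE.CollapseDebris.IsAdmissibleProfile α W →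
      Literature.Analysis.FunctionSpaces.Torus.IsSmooth f →
      Literature.Analysis.FunctionSpaces.Torus.IsDivFree f →
      Literature.Analysis.FunctionSpaces.Torus.HasZeroMean f →
      (∀ (c' σ : ℝ), 0 < σ → σ ≤ 1 → ∃ q : ℝ, 0 < q ∧
        ∀ (ν : ℕ → ℝ) (a : ℕ → UnitAddTorus (Fin 3))
          (u₀ : ℕ → UnitAddTorus (Fin 3) → EuclideanSpace ℝ (Fin 3))
          (u : ℕ → ℝ → UnitAddTorus (Fin 3) → EuclideanSpace ℝ (Fin 3)),
          (∀ j, 0 < ν j) → Filter.Tendsto ν Filter.atTop (nhds 0) →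
          (∀ j, Literature.Analysis.FluidPDE.Torus.IsGlobalLerayHopf (ν j) 0 (u₀ j) (u j)) →
          (∀ j, MeasureTheory.eLpNorm
              (fun x => u₀ j x - Literature.Analysis.FluidPDE.collapseDebris α W (x - a j))
              2 MeasureTheory.volume ≤ ENNReal.ofReal (c' * (ν j) ^ ((3 - 2 * α) / (2 * (1 - α))))) →
          ∀ᶠ j in Filter.atTop, q ≤ ν j * (∫⁻ s in Set.Ioo 0 σ,
            Literature.Analysis.FunctionSpaces.Torus.eGradNormSq (u j s)).toReal) →
      ∃ q : ℝ, 0 < q ∧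
        ∀ (ν : ℕ → ℝ) (a : ℕ → UnitAddTorus (Fin 3))
          (b : ℕ → UnitAddTorus (Fin 3) → EuclideanSpace ℝ (Fin 3))
          (u₀ : ℕ → UnitAddTorus (Fin 3) → EuclideanSpace ℝ (Fin 3))
          (u : ℕ → ℝ → UnitAddTorus (Fin 3) → EuclideanSpace ℝ (Fin 3)),
          (∀ j, 0 < ν j) → Filter.Tendsto ν Filter.atTop (nhds 0) →
          (∀ j, Literature.Analysis.FluidPDE.Torus.IsGlobalLerayHopf (ν j) (fun _ => f) (u₀ j) (u j)) →
          (∀ j, Literature.Analysis.FunctionSpaces.Torus.IsSmooth (b j) ∧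
            Literature.Analysis.FunctionSpaces.Torus.IsDivFree (b j) ∧
            ∀ y : EuclideanSpace ℝ (Fin 3),
              ‖Literature.Analysis.FunctionSpaces.Torus.lift (b j) y‖ ≤ M ∧
              ‖fderiv ℝ (Literature.Analysis.FunctionSpaces.Torus.lift (b j)) y‖ ≤ M) →
          (∀ j, MeasureTheory.eLpNorm
              (fun x => u₀ j x - b j x - Literature.Analysis.FluidPDE.collapseDebris α W (x - a j))
              2 MeasureTheory.volume ≤ ENNReal.ofReal (c * (ν j) ^ ((3 - 2 * α) / (2 * (1 - α))))) →
          ∀ᶠ j in Filter.atTop, q ≤ ν j * (∫⁻ s in Set.Ioo 0 1,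
            Literature.Analysis.FunctionSpaces.Torus.eGradNormSq (u j s)).toReal) :
    ∀ (α : ℝ) (W : EuclideanSpace ℝ (Fin 3) → EuclideanSpace ℝ (Fin 3))
      (f : UnitAddTorus (Fin 3) → EuclideanSpace ℝ (Fin 3)) (M c : ℝ), 2/3 < α → α < 1 →
      Literature.Analysis.FluidPDE.CollapseDebris.IsAdmissibleProfile α W →
      Literature.Analysis.FunctionSpaces.Torus.IsSmooth f →
      Literature.Analysis.FunctionSpaces.Torus.IsDivFree f →
      Literature.Analysis.FunctionSpaces.Torus.HasZeroMean f →
      ∃ q : ℝ, 0 < q ∧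
        ∀ (ν : ℕ → ℝ) (a : ℕ → UnitAddTorus (Fin 3))
          (b : ℕ → UnitAddTorus (Fin 3) → EuclideanSpace ℝ (Fin 3))
          (u₀ : ℕ → UnitAddTorus (Fin 3) → EuclideanSpace ℝ (Fin 3))
          (u : ℕ → ℝ → UnitAddTorus (Fin 3) → EuclideanSpace ℝ (Fin 3)),
          (∀ j, 0 < ν j) → Filter.Tendsto ν Filter.atTop (nhds 0) →
          (∀ j, Literature.Analysis.FluidPDE.Torus.IsGlobalLerayHopf (ν j) (fun _ => f) (u₀ j) (u j)) →
          (∀ j, Literature.Analysis.FunctionSpaces.Torus.IsSmooth (b j) ∧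
            Literature.Analysis.FunctionSpaces.Torus.IsDivFree (b j) ∧
            ∀ y : EuclideanSpace ℝ (Fin 3),
              ‖Literature.Analysis.FunctionSpaces.Torus.lift (b j) y‖ ≤ M ∧
              ‖fderiv ℝ (Literature.Analysis.FunctionSpaces.Torus.lift (b j)) y‖ ≤ M) →
          (∀ j, MeasureTheory.eLpNorm
              (fun x => u₀ j x - b j x - Literature.Analysis.FluidPDE.collapseDebris α W (x - a j))
              2 MeasureTheory.volume ≤ ENNReal.ofReal (c * (ν j) ^ ((3 - 2 * α) / (2 * (1 - α))))) →
          ∀ᶠ j in Filter.atTop, q ≤ ν j * (∫⁻ s in Set.Ioo 0 1,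
            Literature.Analysis.FunctionSpaces.Torus.eGradNormSq (u j s)).toReal := by
  intro α W f M c hα₁ hα₂ hW hf hdf hmf
  exact h₃ α W f M c hα₁ hα₂ hW hf hdf hmf
    (fun c' σ hσ hσ1 => h₂ α W hα₁ hα₂ hW (h₁ α W hα₁ hα₂ hW) c' σ hσ hσ1)

/-- **THE skeleton theorem: the crux BY NAME from the three stubs.** Restart at the good positive
times: for `t_j > 0` with the energy inequality from `t_j`, `s ↦ u_j(s + t_j)` is a global
Leray–Hopf solution forced by `f` from the pinned datum `u_j(t_j)`
(`Torus.IsGlobalLerayHopf.isGlobalLerayHopf_translate`), to which the datum form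
(`datumQuantum_of_stubSigs` fed with the three stubs) applies with the same centres, backgrounds
and tolerance; the burn windows agree by
`setLIntegral_Ioo_comp_add_right`. This is the line's use of the repaired hypothesis `0 < t_j`.
[folklore] -/
theorem RobustDecayQuantumR_of : RobustDecayQuantumR := by
  have hD := datumQuantum_of_stubSigs stub_bareQuantum stub_tipUniversality stub_calmDecoupling
  unfold RobustDecayQuantumR
  dsimp only
  intro α W f M c hα₁ hα₂ hW hf hdf hmf
  obtain ⟨q, hq, hmain⟩ := hD α W f M c hα₁ hα₂ hW hf hdf hmf
  refine ⟨q, hq, ?_⟩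
  intro ν t a b u₀ u hν hν0 hLH hGood hBg htol
  -- restart at the good positive times `t j`
  have hv : ∀ j, Literature.Analysis.FluidPDE.Torus.IsGlobalLerayHopf (ν j) (fun _ => f) (u j (t j))
      (fun s => u j (s + t j)) := fun j =>
    (hLH j).isGlobalLerayHopf_translate hf (le_of_lt (hν j)) (hGood j).1 (hGood j).2
  -- the datum of the restarted problem is within tolerance of background + debris
  have htol' : ∀ j, MeasureTheory.eLpNorm
      (fun x => u j (t j) x - b j x - Literature.Analysis.FluidPDE.collapseDebris α W (x - a j))
      2 MeasureTheory.volume ≤ ENNReal.ofReal (c * (ν j) ^ ((3 - 2 * α) / (2 * (1 - α)))) := by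
    intro j
    simpa only [Literature.Analysis.FluidPDE.collapseDebris_eq] using htol j
  have key := hmain ν a b (fun j => u j (t j)) (fun j s => u j (s + t j)) hν hν0 hv hBg htol'
  -- translate the burn window back
  filter_upwards [key] with j hj
  have hwin : (∫⁻ s in Set.Ioo (0 : ℝ) 1,
      Literature.Analysis.FunctionSpaces.Torus.eGradNormSq (u j (s + t j))) =
      ∫⁻ s in Set.Ioo (t j) (t j + 1), Literature.Analysis.FunctionSpaces.Torus.eGradNormSq (u j s) := by
    have h := Literature.Analysis.FluidPDE.setLIntegral_Ioo_comp_add_right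
      (fun s => Literature.Analysis.FunctionSpaces.Torus.eGradNormSq (u j s)) 0 1 (t j)
    rw [zero_add, show (1 : ℝ) + t j = t j + 1 from add_comm _ _] at h
    exact h
  rw [hwin] at hj
  exact hj

end Summit.AnomalousDissipation.AnomalousDissipation.Cruxes.RobustDecayQuantumR.Birth
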